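import Mathlib
import Literature.Analysis.FunctionSpaces.TorusConvectionLaplacianNormSq
import Literature.Analysis.FunctionSpaces.TorusFluidGlueProofs
import Literature.Analysis.FunctionSpaces.TorusTestFunction
import Literature.Analysis.FluidPDE.NavierStokesConcentrationTools
import HarnessLib

/-!
# The Laplacian of a convective derivative and the `H²` skew identity for transport (instab g8, cell `ns-blowup`, 2026-08-25)

HONEST FRAMING (human ruling D-0035): nothing here is a claim about Navier–Stokes blow-up.
WHAT THIS IS NOT: not NS evidence. Kernel form of the one structural fact behind THEOREM 3-L of
`instab/INSTAB-BRIDGE.md` §11 (and LEMMA R (R2′)/(R3′) of `CERT-ROPE-X0.md` §C): **in `H²` the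
transport operator `(u·∇)` along a divergence-free field is skew up to a commutator of order ≤ 2**,
so it costs `O(‖∇u‖_∞)` in the `H²` energy balance and NOT `ν⁻¹‖u‖²_∞` (the Young-inequality form of
the tree's `Torus.linearisedNS_laplacian_flux_le`). Over the accepted torus calculus
(`Literature.Analysis.*`):

* `laplacian_convect` — the second-order Leibniz rule, pointwise for smooth fields:
  `Δ((v·∇)w) = (v·∇)Δw + 2 ∑ₘ (∂ₘv·∇)∂ₘw + ((Δv)·∇)w`
  (iterate the tree's first-order rule `Torus.partialDeriv_convect_eq_add_convect` and sum with
  `Torus.laplacian_eq_sum_partialDeriv_partialDeriv`).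
* `integral_inner_laplacian_convect_laplacian` — the `H²` SKEW IDENTITY: for smooth divergence-free
  `u` and smooth `w`,
  `∫ ⟪Δ((u·∇)w), Δw⟫ = ∫ ⟪2 ∑ₘ (∂ₘu·∇)∂ₘw + ((Δu)·∇)w, Δw⟫`
  — the top-order term `∫ ⟪(u·∇)Δw, Δw⟫` vanishes by the antisymmetry of transport
  (`Torus.integral_inner_convect_eq_neg`). For `U = abc(1,1,1)` (`ΔU = −U`, `‖∇U‖_F = √3`,
  `|U| ≤ √6`) this is the source of the constants `c₀ ∋ 2√3`, `c₁ ∋ √6` of §11 l.109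
  (`AbcH2TailConstants`).

Additivity of `convect` in either slot is the tree's `Torus.convect_add_left` / `Torus.convect_add_right`
(`NavierStokesConcentrationTools`); the finite-sum versions, the second-order Leibniz rule and the
skew identity are new. Mathlib + Literature only; no new definitions.
-/

noncomputable section

namespace Summit.NavierStokesRegularity.FluidComputer.LaplacianConvectCommutator

open Literature.Analysis.FunctionSpaces Literature.Analysis.FunctionSpaces.Torus MeasureTheory
open scoped RealInnerProductSpace

variable {d : Type*} [Fintype d] [DecidableEq d]
variable {F : Type*} [NormedAddCommGroup F] [InnerProductSpace ℝ F]

omit [DecidableEq d] in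
/-- `(u·∇)` is additive over finite sums in the transported field (for `C¹` summands). -/
theorem convect_finset_sum_right (u : UnitAddTorus d → EuclideanSpace ℝ d) {ι : Type*}
    (s : Finset ι) {f : ι → UnitAddTorus d → F} (hf : ∀ i ∈ s, IsContDiff 1 (f i))
    (x : UnitAddTorus d) :
    convect u (fun y => ∑ i ∈ s, f i y) x = ∑ i ∈ s, convect u (f i) x := by
  classical
  induction s using Finset.induction_on with
  | empty =>
    simp only [Finset.sum_empty]
    -- `(u·∇)0 = 0`: from additivity `(u·∇)(0 + 0) = (u·∇)0 + (u·∇)0`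
    have h0 : IsContDiff 1 (fun _ : UnitAddTorus d => (0 : F)) := isContDiff_const _
    have h := Literature.Analysis.FluidPDE.Torus.convect_add_right u h0 h0 x
    have e : (fun y : UnitAddTorus d => (0 : F) + (0 : F)) = fun _ => (0 : F) := by
      funext y; simp
    rw [e] at h
    -- h : c = c + c
    have : convect u (fun _ : UnitAddTorus d => (0 : F)) x = 0 := by
      have h2 := h; nth_rewrite 1 [← add_zero (convect u (fun _ : UnitAddTorus d => (0:F)) x)] at h2
      exact (add_left_cancel h2).symm
    exact this
  | insert a s ha ih =>
    have hfa : IsContDiff 1 (f a) := hf a (Finset.mem_insert_self a s)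
    have hfs : ∀ i ∈ s, IsContDiff 1 (f i) := fun i hi => hf i (Finset.mem_insert_of_mem hi)
    have hsum : IsContDiff 1 (fun y => ∑ i ∈ s, f i y) := by
      have hl : lift (fun y => ∑ i ∈ s, f i y) = fun z => ∑ i ∈ s, lift (f i) z := rfl
      unfold IsContDiff; rw [hl]
      exact ContDiff.sum fun i hi => hfs i hi
    simp only [Finset.sum_insert ha]
    rw [Literature.Analysis.FluidPDE.Torus.convect_add_right u hfa hsum x, ih hfs]

omit [Fintype d] [DecidableEq d] in
/-- `(·∇)v` is additive over finite sums in the transporting field. -/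
theorem convect_finset_sum_left {ι : Type*} (s : Finset ι) (u : ι → UnitAddTorus d → EuclideanSpace ℝ d)
    (v : UnitAddTorus d → F) (x : UnitAddTorus d) :
    convect (fun y => ∑ i ∈ s, u i y) v x = ∑ i ∈ s, convect (u i) v x := by
  simp only [convect, map_sum]

/-- **Second-order Leibniz rule for the convective derivative.** For smooth `v : T^d → ℝ^d` and
smooth `w : T^d → F`, pointwise
`Δ((v·∇)w) = (v·∇)(Δw) + 2·∑ₘ (∂ₘv·∇)(∂ₘw) + ((Δv)·∇)w`. -/
theorem laplacian_convect {v : UnitAddTorus d → EuclideanSpace ℝ d} {w : UnitAddTorus d → F}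
    (hv : IsSmooth v) (hw : IsSmooth w) (x : UnitAddTorus d) :
    laplacian (convect v w) x =
      convect v (laplacian w) x + (2:ℝ) • (∑ m, convect (partialDeriv m v) (partialDeriv m w) x)
        + convect (laplacian v) w x := by
  have hcw : IsSmooth (convect v w) := hv.convect hw
  -- first-order Leibniz, as an identity of functions
  have h1 : ∀ m, partialDeriv m (convect v w)
      = (convect v (partialDeriv m w)) + (convect (partialDeriv m v) w) := by
    intro m; funext y
    simpa [Pi.add_apply] using partialDeriv_convect_eq_add_convect hv hw m y
  -- second application of the first-order rule to each summand
  have h2 : ∀ m, partialDeriv m (partialDeriv m (convect v w)) x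
      = convect v (partialDeriv m (partialDeriv m w)) x
        + convect (partialDeriv m v) (partialDeriv m w) x
        + (convect (partialDeriv m v) (partialDeriv m w) x
          + convect (partialDeriv m (partialDeriv m v)) w x) := by
    intro m
    have hA : IsContDiff 1 (convect v (partialDeriv m w)) :=
      (hv.convect (hw.partialDeriv m)).isContDiff (by simp)
    have hB : IsContDiff 1 (convect (partialDeriv m v) w) :=
      ((hv.partialDeriv m).convect hw).isContDiff (by simp)
    rw [h1 m, partialDeriv_add hA hB, Pi.add_apply,
      partialDeriv_convect_eq_add_convect hv (hw.partialDeriv m) m x,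
      partialDeriv_convect_eq_add_convect (hv.partialDeriv m) hw m x]
  rw [laplacian_eq_sum_partialDeriv_partialDeriv hcw x]
  simp_rw [h2]
  simp only [Finset.sum_add_distrib]
  -- identify the three groups
  have hΔw : convect v (laplacian w) x = ∑ m, convect v (partialDeriv m (partialDeriv m w)) x := by
    have e : laplacian w = fun y => ∑ m, partialDeriv m (partialDeriv m w) y := by
      funext y; exact laplacian_eq_sum_partialDeriv_partialDeriv hw y
    rw [e, convect_finset_sum_right v Finset.univ
      (fun m _ => ((hw.partialDeriv m).partialDeriv m).isContDiff (by simp)) x]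
  have hΔv : convect (laplacian v) w x = ∑ m, convect (partialDeriv m (partialDeriv m v)) w x := by
    have e : laplacian v = fun y => ∑ m, partialDeriv m (partialDeriv m v) y := by
      funext y; exact laplacian_eq_sum_partialDeriv_partialDeriv hv y
    rw [e, convect_finset_sum_left]
  rw [hΔw, hΔv, two_smul]
  abel

/-- **The `H²` skew identity for transport.** For smooth divergence-free `u` and smooth `w` on
`T^d`, the top-order part of `∫ ⟪Δ((u·∇)w), Δw⟫` vanishes:
`∫ ⟪Δ((u·∇)w), Δw⟫ = ∫ ⟪2 ∑ₘ (∂ₘu·∇)∂ₘw + ((Δu)·∇)w, Δw⟫`,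
because `∫ ⟪(u·∇)Δw, Δw⟫ = −∫ ⟪Δw, (u·∇)Δw⟫` (antisymmetry of transport by a divergence-free
field, `Torus.integral_inner_convect_eq_neg`) forces that term to be zero. Hence
`|∫ ⟪Δ((u·∇)w), Δw⟫| ≤ (2 sup‖∇u‖ · ‖∇²w‖₂ + sup|Δu| · ‖∇w‖₂) · ‖Δw‖₂` — no `ν⁻¹`, no `‖u‖_∞²`
(the commutator form of the `A`-norm estimates, cf. Constantin–Foias 1988, Ch. 10). -/
theorem integral_inner_laplacian_convect_laplacian {u : UnitAddTorus d → EuclideanSpace ℝ d}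
    {w : UnitAddTorus d → F} (hu : IsSmooth u) (hdiv : IsDivFree u) (hw : IsSmooth w) :
    ∫ x, ⟪laplacian (convect u w) x, laplacian w x⟫
      = ∫ x, ⟪(2:ℝ) • (∑ m, convect (partialDeriv m u) (partialDeriv m w) x)
          + convect (laplacian u) w x, laplacian w x⟫ := by
  have hΔw : IsSmooth (laplacian w) := hw.laplacian
  -- the top-order term integrates to zero
  have hskew : ∫ x, ⟪convect u (laplacian w) x, laplacian w x⟫ = 0 := by
    have h := integral_inner_convect_eq_neg hu hdiv hΔw hΔw
    have hsym : ∫ x, ⟪laplacian w x, convect u (laplacian w) x⟫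
        = ∫ x, ⟪convect u (laplacian w) x, laplacian w x⟫ :=
      integral_congr_ae (ae_of_all _ fun x => real_inner_comm _ _)
    rw [hsym] at h
    linarith
  -- integrability of the pieces (continuous functions on a compact space)
  have hc1 : Continuous fun x => ⟪convect u (laplacian w) x, laplacian w x⟫ :=
    ((hu.convect hΔw).continuous).inner hΔw.continuous
  set S : UnitAddTorus d → F := fun x => ∑ m, convect (partialDeriv m u) (partialDeriv m w) x with hS
  have hs : IsSmooth S := by
    have hl : lift S = fun z => ∑ m, lift (convect (partialDeriv m u) (partialDeriv m w)) z := rfl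
    unfold IsSmooth; rw [hl]
    exact ContDiff.sum fun m _ => ((hu.partialDeriv m).convect (hw.partialDeriv m))
  have hrest : IsSmooth ((2:ℝ) • S + convect (laplacian u) w) :=
    (hs.smul (2:ℝ)).add (hu.laplacian.convect hw)
  have hfun : (fun x => (2:ℝ) • (∑ m, convect (partialDeriv m u) (partialDeriv m w) x)
      + convect (laplacian u) w x) = ((2:ℝ) • S + convect (laplacian u) w) := by
    funext x; simp [hS]
  have hc2 : Continuous fun x => ⟪(2:ℝ) • (∑ m, convect (partialDeriv m u) (partialDeriv m w) x)
      + convect (laplacian u) w x, laplacian w x⟫ := by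
    have hc : Continuous (fun x => (2:ℝ) • (∑ m, convect (partialDeriv m u) (partialDeriv m w) x)
      + convect (laplacian u) w x) := by rw [hfun]; exact hrest.continuous
    exact hc.inner hΔw.continuous
  have e : ∀ x, ⟪laplacian (convect u w) x, laplacian w x⟫
      = ⟪convect u (laplacian w) x, laplacian w x⟫
        + ⟪(2:ℝ) • (∑ m, convect (partialDeriv m u) (partialDeriv m w) x)
            + convect (laplacian u) w x, laplacian w x⟫ := by
    intro x
    rw [laplacian_convect hu hw x, ← inner_add_left]
    congr 1
    abel
  simp_rw [e]
  rw [integral_add (hc1.integrable_of_hasCompactSupport (HasCompactSupport.of_compactSpace _))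
    (hc2.integrable_of_hasCompactSupport (HasCompactSupport.of_compactSpace _)), hskew, zero_add]

end Summit.NavierStokesRegularity.FluidComputer.LaplacianConvectCommutator
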